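import Summits.ValiantsHypothesis.ValiantsHypothesis.Theorems.BarrierLeverPriorityPeelingMoves
import Summits.ValiantsHypothesis.ValiantsHypothesis.Theorems.BarrierLeverSplitReductionSufficesForTransversal
import Summits.ValiantsHypothesis.ValiantsHypothesis.Theorems.BarrierLeverPriorityPeelingBase

/-!
# Route BarrierLever — priority peeling for TT: DERIVATIONS (certificates) and their soundness

Helper file (`--supports stmt-ValiantsHypothesis-19152`; cell valiant-natproofs, rung V4, 𝒟-side;
prover gen 7; memo `HOME/prover/gen7/PP-MEMO-g7.md` §5). Closes NO item. It packages the kernel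
moves of the priority-peeling calculus (`pairMove'`, `shearMove'`, tree file `…PriorityPeelingMoves`)
into ONE inductive predicate `PPDerivable nr nc ι e R C` («the configuration with row index maps
`R i : Fin e → Fin nr` and column index maps `C j : Fin e → Fin nc`, `i j : ι`, has a priority-peeling
derivation») and proves its SOUNDNESS `alive_of_ppDerivable`: a derivable configuration is ALIVE
(some complex matrix makes its layout matrix `(det G[R i, C j])_{ij}` nonsingular).

Constructors (= the certificate format for the planners' item «PP certificates exist»): leaves
`rank_zero` (empty index maps, at most one row), `rank_one` (index maps on `Fin 1` with distinct row
literals and distinct column literals), `single` (one row, injective index maps); moves `pair` (the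
pair move: data `ℓ₀ ℓ₁ β pos P S w grp qφ f` exactly as in `pairMove'`, children derivable),
`shear` (data `x y aff qx` as in `shearMove'`, sheared configuration derivable), `transpose`
(swap rows/columns, `G ↦ Gᵀ`), `reindex` (permute the row index and the column index).

`transversalMinorLayoutsNonsingular_of_ppDerivable`: if every injective TT layout `(u, w)` —
read as the configuration `R i a = castAdd h a / natAdd h a` by `a ∈ u i`, `C j c = natAdd h c /
castAdd h c` by `c ∈ w j`, which IS the item's matrix — is derivable, then
`Theses.BarrierLever.TransversalMinorLayoutsNonsingular` (item 19152) holds; hence TNS (19126) and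
`PartitionMinorsHitByVP` (19717) by the tree arrows. Machine search (memo §4, kit j256612) finds a
derivation for every layout tested (h = 3 exhaustively; h ≤ 10 structured; random h ≤ 8).

WHAT THIS IS NOT: the existence of derivations for ALL layouts is OPEN (the proposed residual
conjecture); nothing on crux stmt-ValiantsHypothesis-14610 or on `VP` versus `VNP`.
-/

-- layout Summits/ValiantsHypothesis/ValiantsHypothesis forces the duplicated namespace component
set_option linter.dupNamespace false

namespace Summit.ValiantsHypothesis.ValiantsHypothesis.Theorems.BarrierLever.PriorityPeeling

open Finset Matrix

/-! ## 1. Derivations -/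

/-- **Priority-peeling derivations** of a configuration (row index maps `R`, column index maps `C`
over the index type `ι`, rank `e`, literal spaces `Fin nr`, `Fin nc`). See the module docstring. -/
inductive PPDerivable : ∀ (nr nc : ℕ) (ι : Type) [Fintype ι] [DecidableEq ι] (e : ℕ),
    (ι → Fin e → Fin nr) → (ι → Fin e → Fin nc) → Prop
  | rank_zero {nr nc : ℕ} {ι : Type} [Fintype ι] [DecidableEq ι] [Subsingleton ι]
      (R : ι → Fin 0 → Fin nr) (C : ι → Fin 0 → Fin nc) : PPDerivable nr nc ι 0 R C
  | rank_one {nr nc : ℕ} {ι : Type} [Fintype ι] [DecidableEq ι]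
      (R : ι → Fin 1 → Fin nr) (C : ι → Fin 1 → Fin nc)
      (hR : Function.Injective fun i => R i 0) (hC : Function.Injective fun j => C j 0) :
      PPDerivable nr nc ι 1 R C
  | single {nr nc : ℕ} {ι : Type} [Fintype ι] [DecidableEq ι] {e : ℕ}
      (R : ι → Fin e → Fin nr) (C : ι → Fin e → Fin nc) (i₀ : ι) (hι : ∀ i, i = i₀)
      (hR : Function.Injective (R i₀)) (hC : Function.Injective (C i₀)) : PPDerivable nr nc ι e R C
  | pair {nr nc : ℕ} {ι : Type} [Fintype ι] [DecidableEq ι] {d : ℕ}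
      (R : ι → Fin (d + 1) → Fin nr) (C : ι → Fin (d + 1) → Fin nc)
      (ℓ₀ ℓ₁ : Fin nr) (hℓ : ℓ₀ ≠ ℓ₁) (β : ι → Bool) (pos : ι → Fin (d + 1))
      (hpos : ∀ i, R i (pos i) = if β i then ℓ₁ else ℓ₀)
      (huniq : ∀ i a, a ≠ pos i → R i a ≠ ℓ₀ ∧ R i a ≠ ℓ₁)
      (P S : Finset (Fin nc)) (w : Fin nc → ℕ) (grp : ι → Bool) (qφ : ι → Fin (d + 1))
      (hφ₀ : ∀ j, grp j = false → C j (qφ j) ∈ P ∧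
        ∀ q, C j q ∈ P → q ≠ qφ j → w (C j q) < w (C j (qφ j)))
      (hφ₁ : ∀ j, grp j = true → (∀ q, C j q ∉ P) ∧ C j (qφ j) ∈ S ∧
        ∀ q, C j q ∈ S → q ≠ qφ j → w (C j q) < w (C j (qφ j)))
      (f : Equiv.Perm ι) (hf : ∀ i, β i = grp (f i))
      (h₀ : PPDerivable nr nc {x : ι // β x = false} d
        (fun i => R i ∘ (pos i).succAbove) (fun j => C (f j) ∘ (qφ (f j)).succAbove))
      (h₁ : PPDerivable nr nc {x : ι // ¬ β x = false} d
        (fun i => R i ∘ (pos i).succAbove) (fun j => C (f j) ∘ (qφ (f j)).succAbove)) :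
      PPDerivable nr nc ι (d + 1) R C
  | shear {nr nc : ℕ} {ι : Type} [Fintype ι] [DecidableEq ι] {e : ℕ}
      (R : ι → Fin e → Fin nr) (C : ι → Fin e → Fin nc)
      (hC : ∀ j, Function.Injective (C j)) (x y : Fin nc) (hxy : x ≠ y) (aff : ι → Bool)
      (qx : ι → Fin e) (haff : ∀ j, aff j = true → C j (qx j) = x ∧ ∀ q, C j q ≠ y)
      (hunaff : ∀ j, aff j = false → (∀ q, C j q ≠ x) ∨ (∃ q, C j q = y))
      (h : PPDerivable nr nc ι e R (fun j => if aff j then Function.update (C j) (qx j) y else C j)) :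
      PPDerivable nr nc ι e R C
  | transpose {nr nc : ℕ} {ι : Type} [Fintype ι] [DecidableEq ι] {e : ℕ}
      (R : ι → Fin e → Fin nr) (C : ι → Fin e → Fin nc) (h : PPDerivable nc nr ι e C R) :
      PPDerivable nr nc ι e R C
  | reindex {nr nc : ℕ} {ι : Type} [Fintype ι] [DecidableEq ι] {e : ℕ}
      (R : ι → Fin e → Fin nr) (C : ι → Fin e → Fin nc) (σ τ : Equiv.Perm ι)
      (h : PPDerivable nr nc ι e (fun i => R (σ i)) (fun j => C (τ j))) : PPDerivable nr nc ι e R C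

/-! ## 2. Leaves over a general index type -/

section Leaves

variable {nr nc e : ℕ} {ι : Type} [Fintype ι] [DecidableEq ι]

/-- Rank 0 with at most one row: the layout matrix (all ones) is nonsingular. -/
theorem alive_rank_zero' [Subsingleton ι] (R : ι → Fin 0 → Fin nr) (C : ι → Fin 0 → Fin nc) :
    ∃ G : Matrix (Fin nr) (Fin nc) ℂ,
      (Matrix.of fun i j : ι => (G.submatrix (R i) (C j)).det).det ≠ 0 := by
  refine ⟨0, ?_⟩
  have hM : (Matrix.of fun i j : ι => ((0 : Matrix (Fin nr) (Fin nc) ℂ).submatrix (R i) (C j)).det)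
      = Matrix.of fun _ _ : ι => (1 : ℂ) := by
    ext i j
    simp only [Matrix.of_apply, Matrix.det_isEmpty]
  rw [hM]
  rcases isEmpty_or_nonempty ι with hι | ⟨⟨i₀⟩⟩
  · rw [Matrix.det_isEmpty]
    exact one_ne_zero
  · haveI : Unique ι := ⟨⟨i₀⟩, fun i => Subsingleton.elim i i₀⟩
    rw [Matrix.det_unique, Matrix.of_apply]
    exact one_ne_zero

/-- Rank 1 with distinct row literals and distinct column literals. -/
theorem alive_rank_one' (R : ι → Fin 1 → Fin nr) (C : ι → Fin 1 → Fin nc)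
    (hR : Function.Injective fun i => R i 0) (hC : Function.Injective fun j => C j 0) :
    ∃ G : Matrix (Fin nr) (Fin nc) ℂ,
      (Matrix.of fun i j : ι => (G.submatrix (R i) (C j)).det).det ≠ 0 := by
  refine ⟨Matrix.of fun a m => if ∃ q, R q 0 = a ∧ C q 0 = m then (1 : ℂ) else 0, ?_⟩
  have hM : (Matrix.of fun i j : ι =>
      ((Matrix.of fun a m => if ∃ q, R q 0 = a ∧ C q 0 = m then (1 : ℂ) else 0).submatrix
        (R i) (C j)).det) = (1 : Matrix ι ι ℂ) := by
    ext i j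
    rw [Matrix.of_apply, Matrix.det_unique, Matrix.submatrix_apply, Matrix.of_apply,
      Fin.default_eq_zero]
    by_cases h : i = j
    · subst h
      rw [if_pos ⟨i, rfl, rfl⟩, Matrix.one_apply_eq]
    · rw [Matrix.one_apply_ne h, if_neg]
      rintro ⟨q, h1, h2⟩
      exact h ((hR h1).symm.trans (hC h2))
  rw [hM, Matrix.det_one]
  exact one_ne_zero

/-- One row with injective index maps. -/
theorem alive_single' (R : ι → Fin e → Fin nr) (C : ι → Fin e → Fin nc) (i₀ : ι)
    (hι : ∀ i, i = i₀) (hR : Function.Injective (R i₀)) (hC : Function.Injective (C i₀)) :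
    ∃ G : Matrix (Fin nr) (Fin nc) ℂ,
      (Matrix.of fun i j : ι => (G.submatrix (R i) (C j)).det).det ≠ 0 := by
  haveI : Unique ι := ⟨⟨i₀⟩, hι⟩
  have hdef : (default : ι) = i₀ := hι _
  refine ⟨Matrix.of fun a m => if ∃ q, R i₀ q = a ∧ C i₀ q = m then (1 : ℂ) else 0, ?_⟩
  rw [Matrix.det_unique, Matrix.of_apply, hdef, submatrix_matching_eq_one (R i₀) (C i₀) hR hC,
    Matrix.det_one]
  exact one_ne_zero

/-- Transpose symmetry over a general index type. -/
theorem alive_transpose' (R : ι → Fin e → Fin nr) (C : ι → Fin e → Fin nc)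
    (h : ∃ G : Matrix (Fin nc) (Fin nr) ℂ,
      (Matrix.of fun i j : ι => (G.submatrix (C i) (R j)).det).det ≠ 0) :
    ∃ G : Matrix (Fin nr) (Fin nc) ℂ,
      (Matrix.of fun i j : ι => (G.submatrix (R i) (C j)).det).det ≠ 0 := by
  obtain ⟨G, hG⟩ := h
  refine ⟨G.transpose, ?_⟩
  have hM : (Matrix.of fun i j : ι => (G.transpose.submatrix (R i) (C j)).det) =
      (Matrix.of fun i j : ι => (G.submatrix (C i) (R j)).det).transpose := by
    ext i j
    rw [Matrix.of_apply, Matrix.transpose_apply, Matrix.of_apply, ← Matrix.transpose_submatrix,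
      Matrix.det_transpose]
  rw [hM, Matrix.det_transpose]
  exact hG

/-- Re-indexing symmetry over a general index type. -/
theorem alive_reindex' (R : ι → Fin e → Fin nr) (C : ι → Fin e → Fin nc) (σ τ : Equiv.Perm ι)
    (h : ∃ G : Matrix (Fin nr) (Fin nc) ℂ,
      (Matrix.of fun i j : ι => (G.submatrix (R (σ i)) (C (τ j))).det).det ≠ 0) :
    ∃ G : Matrix (Fin nr) (Fin nc) ℂ,
      (Matrix.of fun i j : ι => (G.submatrix (R i) (C j)).det).det ≠ 0 := by
  obtain ⟨G, hG⟩ := h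
  refine ⟨G, SplitGlue.det_ne_zero_of_submatrix_equiv _ σ τ ?_⟩
  have hM : (Matrix.of fun i j : ι => (G.submatrix (R i) (C j)).det).submatrix σ τ =
      Matrix.of fun i j : ι => (G.submatrix (R (σ i)) (C (τ j))).det := by
    ext i j
    rfl
  rw [hM]
  exact hG

end Leaves

/-! ## 3. Soundness -/

/-- **Soundness of priority-peeling derivations**: a derivable configuration is ALIVE. -/
theorem alive_of_ppDerivable {nr nc : ℕ} {ι : Type} [Fintype ι] [DecidableEq ι] {e : ℕ}
    {R : ι → Fin e → Fin nr} {C : ι → Fin e → Fin nc} (h : PPDerivable nr nc ι e R C) :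
    ∃ G : Matrix (Fin nr) (Fin nc) ℂ,
      (Matrix.of fun i j : ι => (G.submatrix (R i) (C j)).det).det ≠ 0 := by
  induction h with
  | rank_zero R C => exact alive_rank_zero' R C
  | rank_one R C hR hC => exact alive_rank_one' R C hR hC
  | single R C i₀ hι hR hC => exact alive_single' R C i₀ hι hR hC
  | pair R C ℓ₀ ℓ₁ hℓ β pos hpos huniq P S w grp qφ hφ₀ hφ₁ f hf _ _ ih₀ ih₁ =>
    exact pairMove' R C ℓ₀ ℓ₁ hℓ β pos hpos huniq P S w grp qφ hφ₀ hφ₁ f hf ih₀ ih₁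
  | shear R C hC x y hxy aff qx haff hunaff _ ih =>
    exact shearMove' R C hC x y hxy aff qx haff hunaff ih
  | transpose R C _ ih => exact alive_transpose' R C ih
  | reindex R C σ τ _ ih => exact alive_reindex' R C σ τ ih

/-! ## 4. The TT glue -/

/-- **Priority-peeling derivations for every injective layout give TT** (item 19152): the item's
layout matrix of `(u, w)` IS the layout matrix of the configuration read off from `(u, w)`. -/
theorem transversalMinorLayoutsNonsingular_of_ppDerivable
    (hder : ∀ (h r : ℕ) (u w : Fin r → Finset (Fin h)), Function.Injective u → Function.Injective w →
      PPDerivable (h + h) (h + h) (Fin r) h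
        (fun i a => if a ∈ u i then Fin.castAdd h a else Fin.natAdd h a)
        (fun j c => if c ∈ w j then Fin.natAdd h c else Fin.castAdd h c)) :
    Summit.ValiantsHypothesis.ValiantsHypothesis.Theses.BarrierLever.TransversalMinorLayoutsNonsingular := by
  intro h r u w hu hw
  exact alive_of_ppDerivable (hder h r u w hu hw)

end Summit.ValiantsHypothesis.ValiantsHypothesis.Theorems.BarrierLever.PriorityPeeling
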